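import Summits.BirchSwinnertonDyer.BirchSwinnertonDyer.Theorems.ErratumRoadFiveRest3TorsionBranchB
import Summits.BirchSwinnertonDyer.Rank1Residual.X11b.BDPRouteOpenInputFieldSupply
import HarnessLib

/-!
# ROAD B12 at `p ≥ 5` (route `ErratumRoadFive`, classical-data residuals 19702 ∕ 19282 ∕ 19703), PART 3: the
# GUARD `d_K ≠ −3` IS HARMLESS DOWNSTREAM — the guarded B-atom (2.4)∃♭ᴮ|ᵍ gives route p2's composite open input
# over EVERY admissible field `K ≠ ℚ(√−3)`, hence the main-conjecture half `Typed.MissingLowerBoundAt W p` on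
# every surjective pair (the class records consume ONE Hoffstein–Luo ∕ Friedberg–Hoffstein field with `|d_K| > 4`)

Cell `bsd-stepL` (run/shared/lean/pub/bsd-stepL/), seat `bsd-stepL-bdp` (prover g24, 2026-08-27). `--supports
stmt-BirchSwinnertonDyer-19702 --as helper`. THEOREMS ONLY (no definition, no named fact, no `sorry`). Memo:
HOME/proof/PROOF-BDP.md §57 (57.12) and §60. Companion of PART 1 ∕ PART 2
(`ErratumRoadFiveIMCDivClassicalBGuarded{Inv,Atom}FromThm124bTransfer.lean`: the guarded atom display ⟸ {BCS25
Thm 1.2.4 (b), Prop 4.2.2} + FRAME + UB♯|ᵍ + TRANSFER|ᵍ).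

WHY. The items (T) 19702 ∕ (NW) 19703 ∕ ¬ram 19282 conclude the ∀K shapes `P2OpenInputOnTreeAt W p` ⟸ (2.4)∃♭ᴮ
`P2.IMCDivSomeFrameOnTreeB W p` (bdp g16 `Rest3TorsionBranchB`), and at `p ≥ 5` those ∀K shapes include
`K = ℚ(√−3)`, which ROAD B12 does not serve (PROOF-BDP 57.12: BCS25 (disc); UB §43). But every CLASS RECORD of route
p2 instantiates its open input at ONE admissible field chosen by Hoffstein–Luo ∕ Friedberg–Hoffstein with
`|d_K| > 4` (`BDPRouteStatement`, `BDPRouteOpenInputField(EndState)`: `P2.missingLowerBoundAt_of_openInputAtField`,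
`exists_admissibleField_splitAt`). This file threads the guard through bdp g16's T = 0 passage (its proofs
VERBATIM, one extra binder) and lands at the field-level input and at the Typed currency:

* §5 `Rest3TorsionBranchB.imcDivIntFrameB_guarded_of_imcDivSomeFrameB_guarded_of_pNew` — H∃♭ᴮ|ᵍ ⟸ (2.4)∃♭ᴮ|ᵍ +
  the JIMJ18 display (twin of `imcDivIntFrameOnTreeB_of_imcDivSomeFrameB_of_pNew`).
* §6 `Rest3TorsionBranchB.openInput_guarded_of_imcDivIntFrameB_guarded` — the guarded body of
  `P2OpenInputOnTreeAt W p` ⟸ H∃♭ᴮ|ᵍ + control from print (twin of `openInputOnTreeAt_of_imcDivIntFrameB`).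
* §7 `Rest3TorsionBranchB.openInputOnTreeAtField_of_openInput_guarded` — ⟹ `P2.OpenInputOnTreeAtField W p K` at
  every `K` with `d_K ≠ −3` (instantiation).
* §8 `Rest3TorsionBranchB.missingLowerBoundAt_of_openInput_guarded` and
  **`Rest3TorsionBranchB.missingLowerBoundAt_of_imcDivSomeFrameB_guarded_of_pNew`** — `Typed.MissingLowerBoundAt W p`
  on every X11b pair with `p ≥ 5` and `ρ̄` onto, from the published facts of route p2 (+ Hoffstein–Luo for the
  field) and the GUARDED atom: the conclusion carries NO guard.

HONEST FRAMING: CONDITIONAL theorems ((2.4)∃♭ᴮ|ᵍ is an OPEN typed shape — PART 2 derives it from two PRINT facts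
+ FRAME + UB♯|ᵍ + TRANSFER|ᵍ, the last two memo-proved only, with a partner only on the finite-flat locus); the
named facts are carried by name; nothing is discharged, booked or re-labelled (T7); the ∀K items are NOT reached
(they include `ℚ(√−3)`); BSD is proved for no pair.

References: [Castella2018] Thms. 2.3, 3.1, 3.2, §5; [Castella2018Exceptional] Thms. 2.10–2.11; [Castella2018Erratum]
(2.4); [HoffsteinLuo1997] Theorem; [MilneADT2006] I Thm. 4.10(b), Thm. 2.8; arXiv:2405.00270v2 §1.2 (disc);
PROOF-BDP §57.12, §60.
-/

set_option autoImplicit false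
set_option linter.dupNamespace false

noncomputable section

open scoped Classical NumberField Topology

open Filter WeierstrassCurve NumberField IsDedekindDomain Field PowerSeries
open Literature.NumberTheory.EllipticCurves Literature.NumberTheory.EllipticCurves.GreenbergSelmer
open Literature.NumberTheory.EllipticCurves.ModularForms
open Literature.NumberTheory.EllipticCurves.Rank1Residual
open Literature.NumberTheory.EllipticCurves.Rank1Residual.Typed
open Literature.NumberTheory.EllipticCurves.Castella2018
open Literature.NumberTheory.EllipticCurves.Castella2018Exceptional
open Literature.NumberTheory.EllipticCurves.Wuthrich2014
open Literature.NumberTheory.GaloisRepresentations Literature.NumberTheory.GaloisCohomology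
open Literature.NumberTheory.Automorphic
open Summit.BirchSwinnertonDyer.Rank1Residual Summit.BirchSwinnertonDyer.Rank1Residual.X11b
open Summit.BirchSwinnertonDyer.Rank1Residual.X11b.AcSelmer
open Summit.BirchSwinnertonDyer.Rank1Residual.X11b.Halves
open Summit.BirchSwinnertonDyer.BirchSwinnertonDyer.Theorems.SchneiderFreeAdditiveX3

namespace Summit.BirchSwinnertonDyer.BirchSwinnertonDyer.Theorems.Rest3TorsionBranchB

variable {W : WeierstrassCurve ℚ} [W.IsElliptic] [W.IsGloballyMinimal] {p : ℕ} [Fact p.Prime]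

/-! ### §5 H∃♭ᴮ|ᵍ ⟸ (2.4)∃♭ᴮ|ᵍ + the JIMJ18 display -/

/-- **H∃♭ᴮ at every admissible `K ≠ ℚ(√−3)` ⟸ (2.4)∃♭ᴮ at those `K` + the JIMJ18 display** — bdp g16's
`imcDivIntFrameOnTreeB_of_imcDivSomeFrameB_of_pNew` with the guard `NumberField.discr K ≠ -3` threaded (the display
fact is used unguarded). CONDITIONAL on the fact and on the guarded atom; nothing booked.
[cite: Castella2018Exceptional, Thms. 2.10–2.11 (arXiv:1507.04260 pp. 13–14)]
[cite: Castella2018, Thms. 3.1–3.2 (arXiv:1704.06608 p. 9)] [cite: Castella2018Erratum, (2.4) (p. 4)] -/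
theorem imcDivIntFrameB_guarded_of_imcDivSomeFrameB_guarded_of_pNew (hB : thm210_thm211_bdpDisplay_pNew)
    (hD : ∀ (N : ℕ) [NeZero N] (K : Type) [Field K] [NumberField K]
      (Dt : ModularParametrizationData W N) (H : HeegnerDatum N (NumberField.discr K)) (ι : K →+* ℂ)
      (P : (W.baseChange K).toAffine.Point),
      ClassX11b W p → 5 ≤ p → Surj W p → W.conductorNorm ℤ = N → IsImaginaryQuadratic K →
      Odd (NumberField.discr K) → NumberField.discr K ≠ -3 → ¬ (p : ℤ) ∣ NumberField.discr K →
      ¬ p ∣ Units.torsionOrder K → SatisfiesHeegnerHypothesis N K →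
      (W.quadraticTwist (NumberField.discr K : ℚ)).entireLFunction 1 ≠ 0 →
      WeierstrassCurve.Affine.Point.map ι.toRatAlgHom P = heegnerPointComplex Dt H →
      ¬ (p : ℤ) ∣ Dt.c → ¬ IsOfFinAddOrder P →
      ∀ (κ : ZpExtension K p), κ.IsAnticyclotomic →
        ∀ (γ : Field.absoluteGaloisGroup K) [Fact (κ.IsTopGenerator γ)]
          (ι' : PadicAlgCl p ≃+* ℂ) (w₀ : InfinitePlace K) (P' : (W.baseChange K).toAffine.Point),
          WeierstrassCurve.Affine.Point.map w₀.embedding.toRatAlgHom P' = heegnerPointComplex Dt H →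
          ∀ (e : K →+* ℚ_[p]),
            (∀ k : 𝓞 K, k ∈ (primeOfEmbeddingDatum p ι' w₀.embedding).asIdeal ↔ ‖e (k : K)‖ < 1) →
            ∃ (ΩK : ℂ) (Ωp : ℂ_[p]) (Q : PowerSeries 𝓞_ℂ_[p]), ΩK ≠ 0 ∧ ‖Ωp‖ = 1 ∧
              R1.IsBDPLFunctionInt p ι' (primeOfEmbeddingDatum p ι' w₀.embedding) κ γ Dt.f ΩK Ωp Q ∧
              ∀ (𝔭bar : HeightOneSpectrum (𝓞 K)), ((p : ℕ) : 𝓞 K) ∈ 𝔭bar.asIdeal →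
                𝔭bar ≠ primeOfEmbeddingDatum p ι' w₀.embedding →
                (XAc.charIdeal (W.baseChange K) p κ 𝔭bar ∅ γ).map (PowerSeries.map (R1.toCpInt p)) ≤
                  Ideal.span {Q}) :
    ∀ (N : ℕ) [NeZero N] (K : Type) [Field K] [NumberField K]
      (Dt : ModularParametrizationData W N) (H : HeegnerDatum N (NumberField.discr K)) (ι : K →+* ℂ)
      (P : (W.baseChange K).toAffine.Point),
      ClassX11b W p → 5 ≤ p → Surj W p → W.conductorNorm ℤ = N → IsImaginaryQuadratic K →
      Odd (NumberField.discr K) → NumberField.discr K ≠ -3 → ¬ (p : ℤ) ∣ NumberField.discr K →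
      ¬ p ∣ Units.torsionOrder K → SatisfiesHeegnerHypothesis N K →
      (W.quadraticTwist (NumberField.discr K : ℚ)).entireLFunction 1 ≠ 0 →
      WeierstrassCurve.Affine.Point.map ι.toRatAlgHom P = heegnerPointComplex Dt H →
      ¬ (p : ℤ) ∣ Dt.c → ¬ IsOfFinAddOrder P →
      ∀ (κ : ZpExtension K p), κ.IsAnticyclotomic →
        ∀ (γ : Field.absoluteGaloisGroup K) [Fact (κ.IsTopGenerator γ)]
          (ι' : PadicAlgCl p ≃+* ℂ) (w₀ : InfinitePlace K) (P' : (W.baseChange K).toAffine.Point),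
          WeierstrassCurve.Affine.Point.map w₀.embedding.toRatAlgHom P' = heegnerPointComplex Dt H →
          ∀ (e : K →+* ℚ_[p]),
            (∀ k : 𝓞 K, k ∈ (primeOfEmbeddingDatum p ι' w₀.embedding).asIdeal ↔ ‖e (k : K)‖ < 1) →
            ∃ (ΩK : ℂ) (Ωp : ℂ_[p]) (Q : PowerSeries 𝓞_ℂ_[p]), ΩK ≠ 0 ∧ ‖Ωp‖ = 1 ∧
              R1.IsBDPLFunctionInt p ι' (primeOfEmbeddingDatum p ι' w₀.embedding) κ γ Dt.f ΩK Ωp Q ∧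
              R1.BDPValueAtOneIntAt W p e P' Q (W.LFunction p) ∧
              ∀ (𝔭bar : HeightOneSpectrum (𝓞 K)), ((p : ℕ) : 𝓞 K) ∈ 𝔭bar.asIdeal →
                𝔭bar ≠ primeOfEmbeddingDatum p ι' w₀.embedding →
                (XAc.charIdeal (W.baseChange K) p κ 𝔭bar ∅ γ).map (PowerSeries.map (R1.toCpInt p)) ≤
                  Ideal.span {Q} := by
  intro N _ K _ _ Dt H ιK P hX h5 hs hN hK hodd hd3 hpd hμ hHN hLt hP hc hPinf κ hκ γ hγ ι' w₀ P' hP' e he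
  obtain ⟨ΩK, Ωp, Q, hΩK, hΩp, hQ, hdiv⟩ :=
    hD N K Dt H ιK P hX h5 hs hN hK hodd hd3 hpd hμ hHN hLt hP hc hPinf κ hκ γ ι' w₀ P' hP' e he
  obtain ⟨ΩK₀, Ωp₀, u, hΩK₀, hΩp₀, hu, hc0, hcont⟩ := continuousDisplayOnTree_of_pNew hB N K Dt H ιK P
    hX h5 hs hN hK hodd hpd hμ hHN hLt hP hc hPinf κ hκ γ ι' w₀ P' hP' e he
  have hΩp0 : Ωp ≠ 0 := fun h ↦ by rw [h, norm_zero] at hΩp; exact zero_ne_one hΩp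
  have heq := intSeries_constantCoeff_eq_of_isBDPLFunctionInt_of_continuousValues hX.2.1 hK hκ hγ.out
    hΩK₀ hΩK hΩp₀ hΩp0 hcont hc0 hQ
  refine ⟨ΩK, Ωp, Q, hΩK, hΩp, hQ, ⟨u, hu, ?_⟩, hdiv⟩
  rw [← heq]
  exact R1.intSeries_hasValueAt_zero p Q

/-! ### §6 The guarded open input ⟸ H∃♭ᴮ|ᵍ + control from print -/

/-- **Route p2's composite open input at every admissible `K ≠ ℚ(√−3)` ⟸ H∃♭ᴮ at those `K`** — the body of
`P2OpenInputOnTreeAt W p` with the one extra binder, from the guarded H∃♭ᴮ and the one-sided control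
(`p2ControlUpperOnTreeAt_of_facts`: Kolyvagin + Poitou–Tate + local Euler characteristic); bdp g16's
`openInputOnTreeAt_of_imcDivIntFrameB_of_controlUpper` VERBATIM with the guard threaded (frame at the conjugate
prime `𝔭′ = 𝔭_{ι′}`, divisibility at `𝔭bar := 𝔭`, logarithm moved `embAt 𝔭′ → embAt 𝔭` in rank one).
CONDITIONAL on H∃♭ᴮ|ᵍ; nothing booked.
[cite: Castella2018, Thms. 2.3, 3.1, 3.2 and §5 (arXiv:1704.06608 pp. 5, 9, 12)]
[cite: Castella2018Erratum, (2.4) and Thm. 1.1 (pp. 1, 4)] [cite: MilneADT2006, Ch. I, Thm. 4.10(b) and Thm. 2.8] -/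
theorem openInput_guarded_of_imcDivIntFrameB_guarded (hnf : exists_isNewformOf)
    (hGZK : rank_eq_analyticRank_of_analyticRank_le_one)
    (hKo : ∀ (N : ℕ) [NeZero N] (W : WeierstrassCurve ℚ) (K : Type) [Field K] [NumberField K],
      kolyvagin N W K)
    (hPT : ∀ (K : Type) [Field K] [NumberField K], poitouTate_sum_localTatePairing_eq_zero K)
    (hEP : ∀ (K : Type) [Field K] [NumberField K] (v : HeightOneSpectrum (𝓞 K)),
      localEulerPoincareCharacteristic (v.adicCompletion K))
    (hF : ∀ (N : ℕ) [NeZero N] (K : Type) [Field K] [NumberField K]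
      (Dt : ModularParametrizationData W N) (H : HeegnerDatum N (NumberField.discr K)) (ι : K →+* ℂ)
      (P : (W.baseChange K).toAffine.Point),
      ClassX11b W p → 5 ≤ p → Surj W p → W.conductorNorm ℤ = N → IsImaginaryQuadratic K →
      Odd (NumberField.discr K) → NumberField.discr K ≠ -3 → ¬ (p : ℤ) ∣ NumberField.discr K →
      ¬ p ∣ Units.torsionOrder K → SatisfiesHeegnerHypothesis N K →
      (W.quadraticTwist (NumberField.discr K : ℚ)).entireLFunction 1 ≠ 0 →
      WeierstrassCurve.Affine.Point.map ι.toRatAlgHom P = heegnerPointComplex Dt H →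
      ¬ (p : ℤ) ∣ Dt.c → ¬ IsOfFinAddOrder P →
      ∀ (κ : ZpExtension K p), κ.IsAnticyclotomic →
        ∀ (γ : Field.absoluteGaloisGroup K) [Fact (κ.IsTopGenerator γ)]
          (ι' : PadicAlgCl p ≃+* ℂ) (w₀ : InfinitePlace K) (P' : (W.baseChange K).toAffine.Point),
          WeierstrassCurve.Affine.Point.map w₀.embedding.toRatAlgHom P' = heegnerPointComplex Dt H →
          ∀ (e : K →+* ℚ_[p]),
            (∀ k : 𝓞 K, k ∈ (primeOfEmbeddingDatum p ι' w₀.embedding).asIdeal ↔ ‖e (k : K)‖ < 1) →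
            ∃ (ΩK : ℂ) (Ωp : ℂ_[p]) (Q : PowerSeries 𝓞_ℂ_[p]), ΩK ≠ 0 ∧ ‖Ωp‖ = 1 ∧
              R1.IsBDPLFunctionInt p ι' (primeOfEmbeddingDatum p ι' w₀.embedding) κ γ Dt.f ΩK Ωp Q ∧
              R1.BDPValueAtOneIntAt W p e P' Q (W.LFunction p) ∧
              ∀ (𝔭bar : HeightOneSpectrum (𝓞 K)), ((p : ℕ) : 𝓞 K) ∈ 𝔭bar.asIdeal →
                𝔭bar ≠ primeOfEmbeddingDatum p ι' w₀.embedding →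
                (XAc.charIdeal (W.baseChange K) p κ 𝔭bar ∅ γ).map (PowerSeries.map (R1.toCpInt p)) ≤
                  Ideal.span {Q}) :
    ∀ (N : ℕ) [NeZero N] (K : Type) [Field K] [NumberField K]
      (Dt : ModularParametrizationData W N) (H : HeegnerDatum N (NumberField.discr K)) (ι : K →+* ℂ)
      (P : (W.baseChange K).toAffine.Point),
      ClassX11b W p → 5 ≤ p → Surj W p → W.conductorNorm ℤ = N → IsImaginaryQuadratic K →
      Odd (NumberField.discr K) → NumberField.discr K ≠ -3 → ¬ (p : ℤ) ∣ NumberField.discr K →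
      ¬ p ∣ Units.torsionOrder K → SatisfiesHeegnerHypothesis N K →
      (W.quadraticTwist (NumberField.discr K : ℚ)).entireLFunction 1 ≠ 0 →
      WeierstrassCurve.Affine.Point.map ι.toRatAlgHom P = heegnerPointComplex Dt H →
      ¬ (p : ℤ) ∣ Dt.c → ¬ IsOfFinAddOrder P →
      ∀ (κ : ZpExtension K p), κ.IsAnticyclotomic →
        ∀ (γ : Field.absoluteGaloisGroup K) [Fact (κ.IsTopGenerator γ)]
          (𝔭 : HeightOneSpectrum (𝓞 K)) (h𝔭 : ((p : ℕ) : 𝓞 K) ∈ 𝔭.asIdeal)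
          (he : 𝔭.asIdeal.ramificationIdx (𝓞 ℚ) = 1) (hf : 𝔭.asIdeal.inertiaDeg (𝓞 ℚ) = 1),
          IMCLowerWaldspurgerOnTreeAt p κ 𝔭 γ (embAt K p 𝔭 h𝔭 he hf) P := by
  have hC : P2ControlUpperOnTreeAt W p := p2ControlUpperOnTreeAt_of_facts W p hKo hPT hEP
  obtain ⟨ι₀⟩ := PadicAlgCl.nonempty_ringEquiv_complex p
  intro N _ K _ _ Dt H ιK P hX h5 hs hN hK hodd hd3 hpd hμ hHN hLt hP hc hPinf κ hκ γ _ 𝔭 h𝔭 he hf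
  obtain ⟨n, hn, -⟩ := hC N K Dt H ιK P hX h5 hs hN hK hodd hpd hμ hHN hLt hP hc hPinf κ hκ γ 𝔭 h𝔭 he hf
  have hF' := hF N K Dt H ιK P hX h5 hs hN hK hodd hd3 hpd hμ hHN hLt hP hc hPinf κ hκ γ
  subst hN
  obtain ⟨hr, -, -, -⟩ := hX
  obtain ⟨w₀⟩ := (inferInstance : Nonempty (InfinitePlace K))
  have hp2 : p ≠ 2 := by omega
  -- `rank_ℤ E(K) = 1` (Gross–Zagier–Kolyvagin)
  have hrk : (W.baseChange K).mordellWeilRank = 1 :=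
    mordellWeilRank_baseChange_eq_one_of_twist_ne_zero W hGZK hnf hr hK.1 hLt
  -- the datum's complex embedding is `w₀.embedding ∘ τ` for some `τ ∈ Gal(K/ℚ)`, `τ² = 1`
  haveI : IsGalois ℚ K := by
    haveI : Algebra.IsQuadraticExtension ℚ K := ⟨hK.1⟩
    infer_instance
  obtain ⟨σ, hσ⟩ := ComplexEmbedding.exists_comp_symm_eq_of_comp_eq (k := ℚ) w₀.embedding ιK
    (by ext x; simp)
  set τ : K →+* K := ((σ.symm : K ≃ₐ[ℚ] K) : K →+* K) with hτdef
  have hτ : ∀ x, τ (τ x) = x := by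
    intro x
    have hcard : Nat.card (K ≃ₐ[ℚ] K) = 2 := by rw [IsGalois.card_aut_eq_finrank, hK.1]
    have hsq : σ.symm * σ.symm = 1 := by
      have h := pow_card_eq_one' (G := K ≃ₐ[ℚ] K) (x := σ.symm)
      rwa [hcard, pow_two] at h
    have := congrArg (fun g : K ≃ₐ[ℚ] K ↦ g x) hsq
    simpa [hτdef, AlgEquiv.mul_apply] using this
  -- the Galois conjugate `P' = τ_* P` is the Heegner point read through `w₀.embedding`
  set P' := WeierstrassCurve.Affine.Point.map τ.toRatAlgHom P with hP'def
  have hP' : WeierstrassCurve.Affine.Point.map w₀.embedding.toRatAlgHom P' =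
      heegnerPointComplex Dt H := by
    rw [hP'def, WeierstrassCurve.Affine.Point.map_map]
    have hcomp : w₀.embedding.toRatAlgHom.comp τ.toRatAlgHom = ιK.toRatAlgHom := by
      apply AlgHom.ext
      intro x
      have := RingHom.congr_fun hσ x
      simpa [hτdef] using this
    rw [hcomp]
    exact hP
  have hlog : ∀ e : K →+* ℚ_[p], X11b.padicLogOrd W p e P' = X11b.padicLogOrd W p e P := fun e ↦
    R1.padicLogOrd_map_eq_of_rank_one W p e P hp2 τ hτ hrk hPinf
  -- the OTHER degree-one prime `𝔭₁` above `p`, and the log symmetry `𝔭 ↔ 𝔭₁` in rank one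
  obtain ⟨𝔭₁, hne, h𝔭₁, he₁, hf₁⟩ := Three.exists_ne_degreeOne_prime hK.1 (p := p) h𝔭 he hf
  have hsymm : X11b.padicLogOrd W p (embAt K p 𝔭₁ h𝔭₁ he₁ hf₁) P =
      X11b.padicLogOrd W p (embAt K p 𝔭 h𝔭 he hf) P := by
    obtain ⟨ρ, -, hρρ, happ⟩ := exists_algEquiv_embAt_eq_comp (p := p) hK.1 h𝔭 he hf h𝔭₁ he₁ hf₁ hne
    have hcompρ : (embAt K p 𝔭 h𝔭 he hf).comp (ρ : K →+* K) = embAt K p 𝔭₁ h𝔭₁ he₁ hf₁ :=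
      RingHom.ext fun x => (happ x).symm
    rw [← hcompρ, ← R1.padicLogOrd_map_eq_comp]
    exact R1.padicLogOrd_map_eq_of_rank_one W p _ P hp2 (ρ : K →+* K) (fun x => hρρ x) hrk hPinf
  -- THE embedding at `𝔭₁` induces `𝔭₁`
  have hemb₁ : ∀ k : 𝓞 K, k ∈ 𝔭₁.asIdeal ↔ ‖embAt K p 𝔭₁ h𝔭₁ he₁ hf₁ (k : K)‖ < 1 :=
    mem_asIdeal_iff_norm_embAt_lt_one 𝔭₁ h𝔭₁ he₁ hf₁
  -- frame at `𝔭₁ = 𝔭_{ι'}`, divisibility at `𝔭bar := 𝔭`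
  have key : ∀ ι' : PadicAlgCl p ≃+* ℂ, 𝔭₁ = primeOfEmbeddingDatum p ι' w₀.embedding →
      IMCLowerWaldspurgerOnTreeAt p κ 𝔭 γ (embAt K p 𝔭 h𝔭 he hf) P := by
    intro ι' h𝔭eq
    obtain ⟨ΩK, Ωp, Q, -, -, -, ⟨u, hu1, hu⟩, hdivB⟩ :=
      hF' ι' w₀ P' hP' (embAt K p 𝔭₁ h𝔭₁ he₁ hf₁) (by rw [← h𝔭eq]; exact hemb₁)
    have hdiv := hdivB 𝔭 h𝔭 (by rw [← h𝔭eq]; exact hne.symm)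
    have h₁ : IMCLowerWaldspurgerOnTreeAt p κ 𝔭 γ (embAt K p 𝔭₁ h𝔭₁ he₁ hf₁) P :=
      imcLowerWaldspurgerOnTreeAt_of_padicLogOrd_eq W p _ (hlog _)
        (R1.imcLowerWaldspurgerOnTreeAt_of_intValue_of_intDvd hn hdiv hu1.le (W.LFunction p) hu)
    obtain ⟨m, hm, hle⟩ := h₁
    exact ⟨m, hm, by rw [← hsymm]; exact hle⟩
  rcases eq_primeOfEmbeddingDatum_or_eq_trans_starRingAut p ι₀ hK w₀ h𝔭₁ with h | h
  · exact key ι₀ h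
  · exact key _ h

/-! ### §7 ⟹ route p2's open input OVER EVERY FIELD `K ≠ ℚ(√−3)` -/

/-- **The guarded open input gives `P2.OpenInputOnTreeAtField W p K` at every field with `d_K ≠ −3`**
(instantiation; the field-level shape of multr1-p2 gen 27 ∕ `BDPRouteOpenInputField`). [cite: Castella2018Erratum, (2.4) (p. 4)] -/
theorem openInputOnTreeAtField_of_openInput_guarded
    (hA : ∀ (N : ℕ) [NeZero N] (K : Type) [Field K] [NumberField K]
      (Dt : ModularParametrizationData W N) (H : HeegnerDatum N (NumberField.discr K)) (ι : K →+* ℂ)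
      (P : (W.baseChange K).toAffine.Point),
      ClassX11b W p → 5 ≤ p → Surj W p → W.conductorNorm ℤ = N → IsImaginaryQuadratic K →
      Odd (NumberField.discr K) → NumberField.discr K ≠ -3 → ¬ (p : ℤ) ∣ NumberField.discr K →
      ¬ p ∣ Units.torsionOrder K → SatisfiesHeegnerHypothesis N K →
      (W.quadraticTwist (NumberField.discr K : ℚ)).entireLFunction 1 ≠ 0 →
      WeierstrassCurve.Affine.Point.map ι.toRatAlgHom P = heegnerPointComplex Dt H →
      ¬ (p : ℤ) ∣ Dt.c → ¬ IsOfFinAddOrder P →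
      ∀ (κ : ZpExtension K p), κ.IsAnticyclotomic →
        ∀ (γ : Field.absoluteGaloisGroup K) [Fact (κ.IsTopGenerator γ)]
          (𝔭 : HeightOneSpectrum (𝓞 K)) (h𝔭 : ((p : ℕ) : 𝓞 K) ∈ 𝔭.asIdeal)
          (he : 𝔭.asIdeal.ramificationIdx (𝓞 ℚ) = 1) (hf : 𝔭.asIdeal.inertiaDeg (𝓞 ℚ) = 1),
          IMCLowerWaldspurgerOnTreeAt p κ 𝔭 γ (embAt K p 𝔭 h𝔭 he hf) P)
    {K : Type} [Field K] [NumberField K] (hd3 : NumberField.discr K ≠ -3) :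
    P2.OpenInputOnTreeAtField W p K := by
  intro N _ Dt H ι P hX h5 hs hN hK hodd hpd hμ hHN hLt hP hc hPinf κ hκ γ _ 𝔭 h𝔭 he hf
  exact hA N K Dt H ι P hX h5 hs hN hK hodd hd3 hpd hμ hHN hLt hP hc hPinf κ hκ γ 𝔭 h𝔭 he hf

/-! ### §8 ⟹ the main-conjecture half `Typed.MissingLowerBoundAt W p` (no guard left) -/

/-- **The main-conjecture half on every surjective X11b pair at `p ≥ 5` from the GUARDED open input** — the
field is the Hoffstein–Luo field of `exists_admissibleField_splitAt` (`d_K ≡ 1 (mod 8)`, `|d_K| > 4`, every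
`ℓ ∣ N` and `p` split, `L(E^{d_K}, 1) ≠ 0`; `|d_K| > 4` gives `d_K ≠ −3`), then multr1-p2 gen 27's
`P2.missingLowerBoundAt_of_openInputAtField`. CONDITIONAL on the guarded open input; nothing booked.
[cite: HoffsteinLuo1997, Theorem] [cite: Castella2018, Thm. 2.3 (p. 5), Thm. 3.2 (p. 9), §5 (p. 12)]
[cite: Castella2018Erratum, (2.4) (p. 4)] [cite: JetchevSkinnerWan2017, §7.4.1 (pp. 30–31)] -/
theorem missingLowerBoundAt_of_openInput_guarded
    (hGZ : ∀ (N : ℕ) [NeZero N] (W : WeierstrassCurve ℚ) (K : Type) [Field K] [NumberField K],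
      gross_zagier N W K)
    (hKo : ∀ (N : ℕ) [NeZero N] (W : WeierstrassCurve ℚ) (K : Type) [Field K] [NumberField K],
      kolyvagin N W K)
    (hWu : sha_dvd_analyticSha)
    (hGZK : rank_eq_analyticRank_of_analyticRank_le_one) (hmod : hasEntireLFunction_rat)
    (hnf : exists_isNewformOf) (hMaz : mazur_not_dvd_maninConstant_of_odd)
    (hHL : HoffsteinLuo1997_exists_twist_L_one_ne_zero)
    (hPT : ∀ (K : Type) [Field K] [NumberField K], poitouTate_sum_localTatePairing_eq_zero K)
    (hEP : ∀ (K : Type) [Field K] [NumberField K] (v : HeightOneSpectrum (𝓞 K)),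
      localEulerPoincareCharacteristic (v.adicCompletion K))
    (hA : ∀ (N : ℕ) [NeZero N] (K : Type) [Field K] [NumberField K]
      (Dt : ModularParametrizationData W N) (H : HeegnerDatum N (NumberField.discr K)) (ι : K →+* ℂ)
      (P : (W.baseChange K).toAffine.Point),
      ClassX11b W p → 5 ≤ p → Surj W p → W.conductorNorm ℤ = N → IsImaginaryQuadratic K →
      Odd (NumberField.discr K) → NumberField.discr K ≠ -3 → ¬ (p : ℤ) ∣ NumberField.discr K →
      ¬ p ∣ Units.torsionOrder K → SatisfiesHeegnerHypothesis N K →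
      (W.quadraticTwist (NumberField.discr K : ℚ)).entireLFunction 1 ≠ 0 →
      WeierstrassCurve.Affine.Point.map ι.toRatAlgHom P = heegnerPointComplex Dt H →
      ¬ (p : ℤ) ∣ Dt.c → ¬ IsOfFinAddOrder P →
      ∀ (κ : ZpExtension K p), κ.IsAnticyclotomic →
        ∀ (γ : Field.absoluteGaloisGroup K) [Fact (κ.IsTopGenerator γ)]
          (𝔭 : HeightOneSpectrum (𝓞 K)) (h𝔭 : ((p : ℕ) : 𝓞 K) ∈ 𝔭.asIdeal)
          (he : 𝔭.asIdeal.ramificationIdx (𝓞 ℚ) = 1) (hf : 𝔭.asIdeal.inertiaDeg (𝓞 ℚ) = 1),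
          IMCLowerWaldspurgerOnTreeAt p κ 𝔭 γ (embAt K p 𝔭 h𝔭 he hf) P)
    (hX : ClassX11b W p) (hp5 : 5 ≤ p) (hsurj : Surj W p) :
    Typed.MissingLowerBoundAt W p := by
  have hr : W.analyticRank = 1 := hX.1
  have hp2 : p ≠ 2 := hX.2.1
  have hw : W.rootNumber = -1 := by
    rw [WeierstrassCurve.rootNumber_eq_neg_one_pow_analyticRank_of_exists_isNewformOf hnf W, hr]
    norm_num
  obtain ⟨K, _, _, hK, hd8, hBK, hHN, hHp, -, hLt⟩ :=
    exists_admissibleField_splitAt W p hnf hHL hw ∅ (fun q hq ↦ absurd hq (Finset.notMem_empty q)) 4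
  obtain ⟨hodd, hpd, hμ⟩ := admissible_of_discr_mod_eight p hK hd8 hBK hp2 hHp
  have hd3 : NumberField.discr K ≠ -3 := by
    intro h
    rw [h] at hBK
    norm_num at hBK
  exact P2.missingLowerBoundAt_of_openInputAtField W p hGZ hKo hWu hGZK hmod hnf hMaz hPT hEP hK hodd hpd hμ
    hHN hLt (openInputOnTreeAtField_of_openInput_guarded hA hd3) hX hp5 hsurj

/-- **ROAD B12 at `p ≥ 5`, END OF THE LINE IN THE TYPED CURRENCY: the main-conjecture half
`Typed.MissingLowerBoundAt W p` on every X11b pair with `p ≥ 5` and `ρ̄` onto ⟸ the GUARDED atom (2.4)∃♭ᴮ|ᵍ +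
print** (the published facts of route p2, the JIMJ18 display for the value at `𝟙`, Hoffstein–Luo for the field).
Composition §5 → §6 → §8; the guard `d_K ≠ −3` of PARTS 1–2 has disappeared from the conclusion. CONDITIONAL on
(2.4)∃♭ᴮ|ᵍ (OPEN; PART 2 derives it from BCS25 Thm 1.2.4 (b), Prop 4.2.2, FRAME, UB♯|ᵍ, TRANSFER|ᵍ); nothing
booked; X11b stays CONSTRUCTION-SHAPED.
[cite: Castella2018Exceptional, Thms. 2.10–2.11 (arXiv:1507.04260 pp. 13–14)]
[cite: Castella2018, Thms. 2.3, 3.1, 3.2, §5 (arXiv:1704.06608 pp. 5, 9, 12)] [cite: Castella2018Erratum, (2.4) (p. 4)]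
[cite: HoffsteinLuo1997, Theorem] [cite: MilneADT2006, Ch. I, Thm. 4.10(b) and Thm. 2.8] -/
theorem missingLowerBoundAt_of_imcDivSomeFrameB_guarded_of_pNew
    (hGZ : ∀ (N : ℕ) [NeZero N] (W : WeierstrassCurve ℚ) (K : Type) [Field K] [NumberField K],
      gross_zagier N W K)
    (hKo : ∀ (N : ℕ) [NeZero N] (W : WeierstrassCurve ℚ) (K : Type) [Field K] [NumberField K],
      kolyvagin N W K)
    (hWu : sha_dvd_analyticSha)
    (hGZK : rank_eq_analyticRank_of_analyticRank_le_one) (hmod : hasEntireLFunction_rat)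
    (hnf : exists_isNewformOf) (hMaz : mazur_not_dvd_maninConstant_of_odd)
    (hHL : HoffsteinLuo1997_exists_twist_L_one_ne_zero)
    (hPT : ∀ (K : Type) [Field K] [NumberField K], poitouTate_sum_localTatePairing_eq_zero K)
    (hEP : ∀ (K : Type) [Field K] [NumberField K] (v : HeightOneSpectrum (𝓞 K)),
      localEulerPoincareCharacteristic (v.adicCompletion K))
    (hB : thm210_thm211_bdpDisplay_pNew)
    (hD : ∀ (N : ℕ) [NeZero N] (K : Type) [Field K] [NumberField K]
      (Dt : ModularParametrizationData W N) (H : HeegnerDatum N (NumberField.discr K)) (ι : K →+* ℂ)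
      (P : (W.baseChange K).toAffine.Point),
      ClassX11b W p → 5 ≤ p → Surj W p → W.conductorNorm ℤ = N → IsImaginaryQuadratic K →
      Odd (NumberField.discr K) → NumberField.discr K ≠ -3 → ¬ (p : ℤ) ∣ NumberField.discr K →
      ¬ p ∣ Units.torsionOrder K → SatisfiesHeegnerHypothesis N K →
      (W.quadraticTwist (NumberField.discr K : ℚ)).entireLFunction 1 ≠ 0 →
      WeierstrassCurve.Affine.Point.map ι.toRatAlgHom P = heegnerPointComplex Dt H →
      ¬ (p : ℤ) ∣ Dt.c → ¬ IsOfFinAddOrder P →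
      ∀ (κ : ZpExtension K p), κ.IsAnticyclotomic →
        ∀ (γ : Field.absoluteGaloisGroup K) [Fact (κ.IsTopGenerator γ)]
          (ι' : PadicAlgCl p ≃+* ℂ) (w₀ : InfinitePlace K) (P' : (W.baseChange K).toAffine.Point),
          WeierstrassCurve.Affine.Point.map w₀.embedding.toRatAlgHom P' = heegnerPointComplex Dt H →
          ∀ (e : K →+* ℚ_[p]),
            (∀ k : 𝓞 K, k ∈ (primeOfEmbeddingDatum p ι' w₀.embedding).asIdeal ↔ ‖e (k : K)‖ < 1) →
            ∃ (ΩK : ℂ) (Ωp : ℂ_[p]) (Q : PowerSeries 𝓞_ℂ_[p]), ΩK ≠ 0 ∧ ‖Ωp‖ = 1 ∧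
              R1.IsBDPLFunctionInt p ι' (primeOfEmbeddingDatum p ι' w₀.embedding) κ γ Dt.f ΩK Ωp Q ∧
              ∀ (𝔭bar : HeightOneSpectrum (𝓞 K)), ((p : ℕ) : 𝓞 K) ∈ 𝔭bar.asIdeal →
                𝔭bar ≠ primeOfEmbeddingDatum p ι' w₀.embedding →
                (XAc.charIdeal (W.baseChange K) p κ 𝔭bar ∅ γ).map (PowerSeries.map (R1.toCpInt p)) ≤
                  Ideal.span {Q})
    (hX : ClassX11b W p) (hp5 : 5 ≤ p) (hsurj : Surj W p) :
    Typed.MissingLowerBoundAt W p :=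
  missingLowerBoundAt_of_openInput_guarded hGZ hKo hWu hGZK hmod hnf hMaz hHL hPT hEP
    (openInput_guarded_of_imcDivIntFrameB_guarded hnf hGZK hKo hPT hEP
      (imcDivIntFrameB_guarded_of_imcDivSomeFrameB_guarded_of_pNew hB hD)) hX hp5 hsurj

end Summit.BirchSwinnertonDyer.BirchSwinnertonDyer.Theorems.Rest3TorsionBranchB

end
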